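import Summits.BirchSwinnertonDyer.Rank1Residual.Additive.CongruentLambdaShiftOfEPWTorsionIso
import Literature.NumberTheory.EllipticCurves.GreenbergVatsal2000.MuLambdaTransferRamifiedOrdinary
import Literature.NumberTheory.EllipticCurves.AnomalousOfRationalTorsionProofs
import HarnessLib

/-!
# Route G's typed input `CongruentLambdaShift` and the `μ = 0` transfer on congruent ADDITIVE pairs
# WITHOUT an irreducibility binder — the X3♯(G-ord) node for real (ARM α; cell `b2b-bsdres`, lane
# CLASS-CLOSURE, seat cc-typer-2 = typer of record N10 §3.2 / O7 §3.3; team n1011 lead R5-42 (b))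

HONEST FRAMING (cell `b2b-bsdres`, run/shared/lean/b2b/bsd-rank1-residual/, verbatim in every file):
the goal of the cell is to DELETE the COMBINATION-SHAPED residual classes of the Birch–Swinnerton-Dyer
formula for ALL analytic-rank `≤ 1` elliptic curves over `ℚ` — assembled STRICTLY from published
theorems — so that the rank-`≤ 1` remainder becomes exactly the CONSTRUCTION-SHAPED classes, which are
TYPED (missing-input `Prop`s), NOT attempted. This is not "finishing BSD". Team n1011 / lane
CLASS-CLOSURE: research routes on the CONSTRUCTION-SHAPED classes X3♯ / X4♯ (N10 / N11); no claim
beyond stated classes; census output = EVIDENCE, never a Literature fact; RESIDUAL-MAP marks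
UNCHANGED; nothing is booked by this file. Theorems plus ONE typed-input predicate
(`RamifiedLineKummerEqAt`, a `Prop` with a body, nothing asserted): NO new named fact, NO conjecture
node. The named fact `hGV` (`GreenbergVatsal2000.muLambdaAlg_transfer_of_torsionIso_potOrd_of_not_dvd_torsionOrder`:
GV 2000 §2 Props. (2.1)/(2.4)/(2.8) + Remarks (2.7)/(2.9)/(2.10), Cor. (2.3), pp. 26–27, with
Greenberg 1999 Prop. 4.14, at the ramified ordinary line — the REDUCIBLE-friendly twin of the EPW
record, `E₁(ℚ)[p] = E₂(ℚ)[p] = 0` in place of "`ρ̄` irreducible"; COMPOSED CITATION, C-audited by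
n1011-lit LIT-INPUTS-P3 §42) enters as a HYPOTHESIS, and so does — per curve — the identification of
the Kummer condition with Greenberg's condition at the line (ARM δ), typed ONCE as
`RamifiedLineKummerEqAt W p` (§0; theorem-shaped: Coates–Greenberg 1996 in print; team n1011 row
T-RD-Δ-K = seat p05 in the kernel on the defect-`2` rows).

WHY (route planner 2, ROUTE-2 §II.16.1 kernel finding + repair (iv)): p10's
`ClassX3Gord.congruentLambdaShift_of_epw_of_torsionIso` carries BOTH `hX₁ : ClassX3Gord W₁ p`
(`⊃ ¬ Irr`) and `hirr` — jointly unsatisfiable (`hX₁.1.1 hirr : False`), never to be cited as X3♯(G-ord)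
coverage of Route G's node `X1.CongruenceTransfer.CongruentLambdaShift`; the EPW record is
INAPPLICABLE on X3 rows. This file gives the X3 node for real by the fact swap `hEPW ↦ hGV`,
`hirr ↦ (htors₁, htors₂, hRD₁, hRD₂)`; the line data and the line-respecting isomorphism are the
TB-ROL lineage's IMAGE-FREE `exists_epwLineData_of_goodOrd_pStar_twist`, unchanged.

WHAT: §0 `RamifiedLineKummerEqAt W p` (typed δ-input; one statement one owner — the PROOF is p05's
row, this file names the binder). §1 `congruentLambdaShift_of_gv`, `mu_eq_zero_of_gv` — lines explicit:
`W₁, W₂/ℚ` globally minimal, `p ≠ 2`, ramified ordinary lines `L₁, L₂` at `v ∋ p`, `p ∤ #Eᵢ(ℚ)_tors`,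
`RamifiedLineKummerEqAt Wᵢ p`, a `Γ_ℚ`-equivariant `E₁[p] ≃ E₂[p]` carrying `C₁[p]` to `C₂[p]`,
`Σ₀ ∌ p` outside which both curves are good ⟹ `CongruentLambdaShift W₁ W₂ p (Σ_{v∈Σ₀} (δ(E₂,v) −
δ(E₁,v)))` and `μ(X₁) = 0 ⟹ μ(X₂) = 0` (image-free twins of cc-typer-1's `…_of_epw`). §2
`…_of_goodOrd_pStar_twists` — two `p*`-twist models of good-ordinary curves (defect-`2` rows). §3
**`ClassX3Gord.congruentLambdaShift_of_gv_of_torsionIso`** (the decl named in II.16.1 (iv)) and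
`ClassX3Gord.mu_eq_zero_of_gv_of_torsionIso` — NO image binder (the consistency probe at the end of
the file is needed by no binder set here); X4♯(G-ord) twins `ClassX4Gord.…_of_gv_…` with the torsion
conditions DISCHARGED from irreducibility (Mazur) — an EPW-free second source for the X4 node.
Remaining per-pair inputs on X3♯(G-ord): `TorsionIso` (exact `E[p]`-iso certificate), `p ∤
#Eᵢ(ℚ)_tors` (census: all 15 802 corner rows), `RamifiedLineKummerEqAt Wᵢ p` (kernel, in flight),
`Σ₀`, and the partner's budget (p07 / p12 consumers). X3♯(G-ord) stays CONSTRUCTION-SHAPED; nothing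
booked. D-0026: ONE Summits-side definition (the binder's name), NO new named fact here.

References: Greenberg–Vatsal, Invent. Math. 142 (2000) §2 Prop. (2.8) + Remark (2.9), Cor. (2.3),
Prop. (2.4), pp. 26–27 [GreenbergVatsal2000]; Greenberg, LNM 1716 (1999) Prop. 4.14, Prop. 2.4
[GreenbergLNM1716]; Coates, LNM 1716 (1999) p. 31 (62)–(63) [CoatesLNM1716]; Coates–Greenberg, Invent.
Math. 124 (1996) Props. 4.3/4.8 [CoatesGreenberg1996];
Emerton–Pollack–Weston 2006 §3.1 (the line datum `A'`) [EmertonPollackWeston2006]; Mazur 1977 III §5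
p. 157 [Mazur1977]; cells/n1011/ROUTE-2.md II.15.4 / II.16.1; cells/n1011/PLAN.md R5-42 (b).
-/

set_option autoImplicit false

noncomputable section

open scoped Classical NumberField

open NumberField IsDedekindDomain Field WeierstrassCurve
  Literature.NumberTheory.GaloisRepresentations
  Literature.NumberTheory.EllipticCurves
  Literature.NumberTheory.EllipticCurves.Rank1Residual
  Literature.NumberTheory.EllipticCurves.GreenbergSelmer
  Literature.NumberTheory.EllipticCurves.GreenbergVatsal2000
  Literature.NumberTheory.EllipticCurves.EmertonPollackWeston2006
  Summit.BirchSwinnertonDyer.Rank1Residual.X1.CongruenceTransfer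

namespace Summit.BirchSwinnertonDyer.Rank1Residual.Additive

/-! ## §0. The typed δ-input: Kummer condition = Greenberg's condition at the ramified line -/

section Delta

variable (W : WeierstrassCurve ℚ) [W.IsElliptic] (p : ℕ) [Fact p.Prime]

/-- **The R-D identification at a ramified ordinary line (ARM δ), TYPED.** For every cyclotomic
`ℤ_p`-extension `κ` (`ker κ = Gal(ℚ̄/ℚ_∞)`), the place `v ∋ p` and every ramified ordinary line `L`
at `v` (`IsRamifiedOrdinaryLine W p L`: additive, potentially ordinary or potentially multiplicative
reduction at `p`), Greenberg's condition at the place above `v` (`L.greenbergKer`: classes of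
`H¹(ker κ, E[p^∞])` dying in `H¹(ker κ ⊓ I_v, E[p^∞]/C)`, GV's `L_𝔭` pulled back) and the Kummer
condition there (`W.localKerOver`: classes dying in `H¹(G_{(ℚ_∞)_𝔭}, E(ℚ̄_𝔭))`) cut out THE SAME
subgroup. In print: Coates–Greenberg 1996 Props. 4.3/4.8 at the deeply ramified `(ℚ_∞)_𝔭`
(`im κ_𝔭 = ker(H¹(A) → H¹(D))`, printed for `F(E_{p^∞})` as Coates LNM 1716 (62)–(63); primary not
held, acq-06010) together with `D^{I_𝔭} = 0` (strict = non-strict); in the KERNEL on the defect-`2`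
rows: Greenberg LNM 1716 Prop. 2.4 over the tame field (record A239
`Greenberg1999.imKummer_ge_strictCondition_goodOrdinary`) + the prime-to-`p` descent of team n1011's
row T-RD-Δ-K (seat p05; the `⊆` half through X2's `localKerOver_le_greenbergKer` on the good-ordinary
twist and additive-p1's `TwistTransportLocal`). A typed INPUT (`Prop` with a body; nothing asserted;
theorem-shaped, not a conjecture); one statement, one owner: its proof is p05's row — this file only
names the binder that the GV record `muLambdaAlg_transfer_of_torsionIso_potOrd_of_not_dvd_torsionOrder` takes
per curve. [cite: GreenbergVatsal2000, §2 p. 26 ("im(κ_𝔭) = L_𝔭") and p. 16 (L_𝔭)]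
[cite: CoatesLNM1716, p. 31 (62)–(63)] [cite: GreenbergLNM1716, §2 Prop. 2.4 (p. 80)] -/
def RamifiedLineKummerEqAt : Prop :=
  ∀ (κ : ZpExtension ℚ p), κ.IsCyclotomic →
    ∀ (v : HeightOneSpectrum (𝓞 ℚ)), ((p : ℕ) : 𝓞 ℚ) ∈ v.asIdeal →
    ∀ (L : LocalDatum ℚ (W.geomPrimaryTorsion p) v), IsRamifiedOrdinaryLine W p L →
      L.greenbergKer κ.kerSubgroup = W.localKerOver p κ.kerSubgroup (v.adicCompletion ℚ)

end Delta

/-! ## §1. Line data explicit: the image-free twins of `congruentLambdaShift_of_epw` / `mu_eq_zero_of_epw` -/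

section Lines

variable (W₁ W₂ : WeierstrassCurve ℚ) [W₁.IsElliptic] [W₁.IsGloballyMinimal] [W₂.IsElliptic]
  [W₂.IsGloballyMinimal] (p : ℕ) [Fact p.Prime] (S₀ : Finset (HeightOneSpectrum (𝓞 ℚ)))

/-- **Route G's typed input at an additive potentially-ordinary prime, image-free:
`CongruentLambdaShift W₁ W₂ p e` with `e = Σ_{v∈Σ₀} (δ(E₂,v) − δ(E₁,v))`, from the cited GV §2
transfer.** Hypotheses: the named fact `hGV`, `p ≠ 2`, the place `v ∋ p`, ramified ordinary lines
`L₁`, `L₂` (`IsRamifiedOrdinaryLine`), `p ∤ #E₁(ℚ)_tors`, `p ∤ #E₂(ℚ)_tors`, a `Γ_ℚ`-equivariant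
`E₁[p] ≃ E₂[p]` carrying `C₁[p]` to `C₂[p]`, `Σ₀ ∌ p` outside which both curves have good reduction.
(The `TorsionIso` premise inside `CongruentLambdaShift` is implied by the line-respecting isomorphism;
the second `μ = 0` premise inside the schema is not used — it is transferred.)
[cite: GreenbergVatsal2000, §2 Prop. (2.8) with Remark (2.9), Cor. (2.3), Prop. (2.4), pp. 26–27 (arXiv:math/9906215 pp. 20–27)] -/
theorem congruentLambdaShift_of_gv
    (hGV : muLambdaAlg_transfer_of_torsionIso_potOrd_of_not_dvd_torsionOrder) (hp : p ≠ 2)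
    {v : HeightOneSpectrum (𝓞 ℚ)} (hv : ((p : ℕ) : 𝓞 ℚ) ∈ v.asIdeal)
    {L₁ : LocalDatum ℚ (W₁.geomPrimaryTorsion p) v} {L₂ : LocalDatum ℚ (W₂.geomPrimaryTorsion p) v}
    (hL₁ : IsRamifiedOrdinaryLine W₁ p L₁) (hL₂ : IsRamifiedOrdinaryLine W₂ p L₂)
    (htors₁ : ¬ p ∣ W₁.torsionOrder) (htors₂ : ¬ p ∣ W₂.torsionOrder)
    (hRD₁ : RamifiedLineKummerEqAt W₁ p) (hRD₂ : RamifiedLineKummerEqAt W₂ p)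
    (hiso : ∃ e : geomTorsion W₁ (p : ℤ) ≃+ geomTorsion W₂ (p : ℤ),
      (∀ (σ : absoluteGaloisGroup ℚ) (P : geomTorsion W₁ (p : ℤ)), e (σ • P) = σ • e P) ∧
      (∀ P : geomTorsion W₁ (p : ℤ),
        AddSubgroup.inclusion (geomTorsion_le_geomPrimaryTorsion W₁ p) P ∈ L₁.plus ↔
          AddSubgroup.inclusion (geomTorsion_le_geomPrimaryTorsion W₂ p) (e P) ∈ L₂.plus))
    (hS₀ : ∀ w ∈ S₀, ((p : ℕ) : 𝓞 ℚ) ∉ w.asIdeal)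
    (hS₁ : ∀ w : HeightOneSpectrum (𝓞 ℚ), w ∉ S₀ → ((p : ℕ) : 𝓞 ℚ) ∉ w.asIdeal →
      W₁.HasGoodReductionAt w)
    (hS₂ : ∀ w : HeightOneSpectrum (𝓞 ℚ), w ∉ S₀ → ((p : ℕ) : 𝓞 ℚ) ∉ w.asIdeal →
      W₂.HasGoodReductionAt w) :
    CongruentLambdaShift W₁ W₂ p (∑ w ∈ S₀, ((delta W₂ p w : ℤ) - (delta W₁ p w : ℤ))) := by
  intro _ κ γ hκ hγ hγ' D₁ D₂ _ _ hX₁ hX₂ hμ₁ _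
  obtain ⟨-, hlam⟩ := hGV W₁ W₂ p hp v hv L₁ L₂ hL₁ hL₂ htors₁ htors₂ hiso S₀ hS₀ hS₁ hS₂ κ γ hκ hγ
    hγ' (hRD₁ κ hκ v hv L₁ hL₁) (hRD₂ κ hκ v hv L₂ hL₂) D₁ D₂ hX₁ hX₂ hμ₁
  rw [Finset.sum_sub_distrib]
  have h' : ((lambdaInvariant p D₁.X + ∑ w ∈ S₀, delta W₁ p w : ℕ) : ℤ) =
      ((lambdaInvariant p D₂.X + ∑ w ∈ S₀, delta W₂ p w : ℕ) : ℤ) := by rw [hlam]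
  push_cast at h'
  linarith

/-- **The `μ = 0` transfer along an additive congruence, image-free** (GV p. 27 "if `μ_{E₁} = 0`, then
`μ_{E₂} = 0`", at the ramified ordinary line): same hypotheses; for the cyclotomic data and all finitely
generated `Λ`-torsion dual data, `μ(X(E₁)) = 0 ⟹ μ(X(E₂)) = 0`.
[cite: GreenbergVatsal2000, §2 Prop. (2.8) with Remark (2.9), Cor. (2.3), pp. 26–27 (arXiv:math/9906215)] -/
theorem mu_eq_zero_of_gv
    (hGV : muLambdaAlg_transfer_of_torsionIso_potOrd_of_not_dvd_torsionOrder) (hp : p ≠ 2)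
    {v : HeightOneSpectrum (𝓞 ℚ)} (hv : ((p : ℕ) : 𝓞 ℚ) ∈ v.asIdeal)
    {L₁ : LocalDatum ℚ (W₁.geomPrimaryTorsion p) v} {L₂ : LocalDatum ℚ (W₂.geomPrimaryTorsion p) v}
    (hL₁ : IsRamifiedOrdinaryLine W₁ p L₁) (hL₂ : IsRamifiedOrdinaryLine W₂ p L₂)
    (htors₁ : ¬ p ∣ W₁.torsionOrder) (htors₂ : ¬ p ∣ W₂.torsionOrder)
    (hRD₁ : RamifiedLineKummerEqAt W₁ p) (hRD₂ : RamifiedLineKummerEqAt W₂ p)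
    (hiso : ∃ e : geomTorsion W₁ (p : ℤ) ≃+ geomTorsion W₂ (p : ℤ),
      (∀ (σ : absoluteGaloisGroup ℚ) (P : geomTorsion W₁ (p : ℤ)), e (σ • P) = σ • e P) ∧
      (∀ P : geomTorsion W₁ (p : ℤ),
        AddSubgroup.inclusion (geomTorsion_le_geomPrimaryTorsion W₁ p) P ∈ L₁.plus ↔
          AddSubgroup.inclusion (geomTorsion_le_geomPrimaryTorsion W₂ p) (e P) ∈ L₂.plus))
    (hS₀ : ∀ w ∈ S₀, ((p : ℕ) : 𝓞 ℚ) ∉ w.asIdeal)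
    (hS₁ : ∀ w : HeightOneSpectrum (𝓞 ℚ), w ∉ S₀ → ((p : ℕ) : 𝓞 ℚ) ∉ w.asIdeal →
      W₁.HasGoodReductionAt w)
    (hS₂ : ∀ w : HeightOneSpectrum (𝓞 ℚ), w ∉ S₀ → ((p : ℕ) : 𝓞 ℚ) ∉ w.asIdeal →
      W₂.HasGoodReductionAt w)
    {κ : ZpExtension ℚ p} {γ : absoluteGaloisGroup ℚ} (hκ : κ.IsCyclotomic)
    (hγ : κ.IsTopGenerator γ) (hγ' : IsCyclotomicVariable p γ)
    (D₁ : W₁.SelmerDualData κ γ) (D₂ : W₂.SelmerDualData κ γ)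
    [Module.Finite (IwasawaAlgebra p) D₁.X] [Module.Finite (IwasawaAlgebra p) D₂.X]
    (hX₁ : D₁.IsTorsion) (hX₂ : D₂.IsTorsion) (hμ₁ : D₁.mu = 0) : D₂.mu = 0 :=
  (hGV W₁ W₂ p hp v hv L₁ L₂ hL₁ hL₂ htors₁ htors₂ hiso S₀ hS₀ hS₁ hS₂ κ γ hκ hγ hγ'
    (hRD₁ κ hκ v hv L₁ hL₁) (hRD₂ κ hκ v hv L₂ hL₂) D₁ D₂ hX₁ hX₂ hμ₁).1

end Lines

/-! ## §2. Two `p*`-twist models of good-ordinary curves (defect-`2` (G-ord) rows): lines supplied -/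

section Twists

variable {p : ℕ} [hp : Fact p.Prime]

/-- The place `v_p` of `ℚ` above the prime `p` exists (`(p)` lies in a maximal ideal of `𝓞 ℚ`,
non-zero since `p ≠ 0`). Local copy of the private lemma of `CongruentLambdaShiftOfEPWTorsionIso`.
[folklore] -/
private theorem exists_natCast_mem_asIdeal' :
    ∃ v : HeightOneSpectrum (𝓞 ℚ), ((p : ℕ) : 𝓞 ℚ) ∈ v.asIdeal := by
  have hnu : ¬ IsUnit ((p : ℕ) : 𝓞 ℚ) := by
    intro h
    have h' := h.map Rat.ringOfIntegersEquiv
    rw [map_natCast, Int.isUnit_iff_natAbs_eq, Int.natAbs_natCast] at h'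
    exact hp.out.one_lt.ne' h'
  obtain ⟨M, hM, hle⟩ := Ideal.exists_le_maximal (Ideal.span {((p : ℕ) : 𝓞 ℚ)})
    (by rwa [Ne, Ideal.span_singleton_eq_top])
  have hpM : ((p : ℕ) : 𝓞 ℚ) ∈ M := hle (Ideal.mem_span_singleton_self _)
  refine ⟨⟨M, hM.isPrime, fun hbot ↦ ?_⟩, hpM⟩
  rw [hbot, Ideal.mem_bot] at hpM
  exact hp.out.ne_zero (by exact_mod_cast hpM)

variable (p)

/-- **`CongruentLambdaShift` from GV + `TorsionIso`, for two `p*`-twist models of good-ordinary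
curves, image-free.** `p` odd; `W₁ = C₁ • V₁^{(p*)}`, `W₂ = C₂ • V₂^{(p*)}` with `V₁`, `V₂` globally
minimal good ordinary at `p`; `p ∤ #E₁(ℚ)_tors`, `p ∤ #E₂(ℚ)_tors`; `TorsionIso W₁ W₂ p`; `Σ₀ ∌ p`
outside which both curves are good. Then `CongruentLambdaShift W₁ W₂ p (Σ_{w∈Σ₀} (δ(E₂,w) − δ(E₁,w)))`;
the lines and the line-respecting isomorphism are `exists_epwLineData_of_goodOrd_pStar_twist` at `v_p`.
[cite: GreenbergVatsal2000, §2 Prop. (2.8) with Remark (2.9), Cor. (2.3), Prop. (2.4), pp. 26–27 (arXiv:math/9906215)]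
[cite: EmertonPollackWeston2006, p. 3 and §3.1 (eq:ordes) (arXiv:math/0404484 p. 17) (the line datum)] -/
theorem congruentLambdaShift_of_gv_of_goodOrd_pStar_twists
    (hGV : muLambdaAlg_transfer_of_torsionIso_potOrd_of_not_dvd_torsionOrder) (hp2 : p ≠ 2)
    {W₁ W₂ : WeierstrassCurve ℚ} [W₁.IsElliptic] [W₁.IsGloballyMinimal] [W₂.IsElliptic]
    [W₂.IsGloballyMinimal]
    (V₁ V₂ : WeierstrassCurve ℚ) [V₁.IsElliptic] [V₁.IsGloballyMinimal] [V₂.IsElliptic]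
    [V₂.IsGloballyMinimal]
    (hCW₁ : ∃ C₁ : VariableChange ℚ, C₁ • V₁.quadraticTwist ((-1 : ℚ) ^ (p / 2) * p) = W₁)
    (hCW₂ : ∃ C₂ : VariableChange ℚ, C₂ • V₂.quadraticTwist ((-1 : ℚ) ^ (p / 2) * p) = W₂)
    (hV₁ : GoodOrd V₁ p) (hV₂ : GoodOrd V₂ p)
    (htors₁ : ¬ p ∣ W₁.torsionOrder) (htors₂ : ¬ p ∣ W₂.torsionOrder)
    (hRD₁ : RamifiedLineKummerEqAt W₁ p) (hRD₂ : RamifiedLineKummerEqAt W₂ p) (hT : TorsionIso W₁ W₂ p)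
    (S₀ : Finset (HeightOneSpectrum (𝓞 ℚ))) (hS₀ : ∀ w ∈ S₀, ((p : ℕ) : 𝓞 ℚ) ∉ w.asIdeal)
    (hS₁ : ∀ w : HeightOneSpectrum (𝓞 ℚ), w ∉ S₀ → ((p : ℕ) : 𝓞 ℚ) ∉ w.asIdeal →
      W₁.HasGoodReductionAt w)
    (hS₂ : ∀ w : HeightOneSpectrum (𝓞 ℚ), w ∉ S₀ → ((p : ℕ) : 𝓞 ℚ) ∉ w.asIdeal →
      W₂.HasGoodReductionAt w) :
    CongruentLambdaShift W₁ W₂ p (∑ w ∈ S₀, ((delta W₂ p w : ℤ) - (delta W₁ p w : ℤ))) := by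
  obtain ⟨v, hv⟩ := exists_natCast_mem_asIdeal' (p := p)
  obtain ⟨L₁, L₂, hL₁, hL₂, hiso⟩ :=
    exists_epwLineData_of_goodOrd_pStar_twist p hp2 V₁ V₂ hCW₁ hCW₂ hV₁ hV₂ hT hv
  exact congruentLambdaShift_of_gv W₁ W₂ p S₀ hGV hp2 hv hL₁ hL₂ htors₁ htors₂ hRD₁ hRD₂ hiso hS₀ hS₁
    hS₂

/-- **`μ = 0` transfer from GV + `TorsionIso`, for two `p*`-twist models of good-ordinary curves,
image-free:** under the hypotheses of the previous theorem, for the cyclotomic data and torsion dual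
data `D₁`, `D₂`: `μ(X(E₁)) = 0 ⟹ μ(X(E₂)) = 0`.
[cite: GreenbergVatsal2000, §2 Prop. (2.8) with Remark (2.9), Cor. (2.3), pp. 26–27 (arXiv:math/9906215)]
[cite: EmertonPollackWeston2006, p. 3 and §3.1 (eq:ordes) (arXiv:math/0404484 p. 17) (the line datum)] -/
theorem mu_eq_zero_of_gv_of_goodOrd_pStar_twists
    (hGV : muLambdaAlg_transfer_of_torsionIso_potOrd_of_not_dvd_torsionOrder) (hp2 : p ≠ 2)
    {W₁ W₂ : WeierstrassCurve ℚ} [W₁.IsElliptic] [W₁.IsGloballyMinimal] [W₂.IsElliptic]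
    [W₂.IsGloballyMinimal]
    (V₁ V₂ : WeierstrassCurve ℚ) [V₁.IsElliptic] [V₁.IsGloballyMinimal] [V₂.IsElliptic]
    [V₂.IsGloballyMinimal]
    (hCW₁ : ∃ C₁ : VariableChange ℚ, C₁ • V₁.quadraticTwist ((-1 : ℚ) ^ (p / 2) * p) = W₁)
    (hCW₂ : ∃ C₂ : VariableChange ℚ, C₂ • V₂.quadraticTwist ((-1 : ℚ) ^ (p / 2) * p) = W₂)
    (hV₁ : GoodOrd V₁ p) (hV₂ : GoodOrd V₂ p)
    (htors₁ : ¬ p ∣ W₁.torsionOrder) (htors₂ : ¬ p ∣ W₂.torsionOrder)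
    (hRD₁ : RamifiedLineKummerEqAt W₁ p) (hRD₂ : RamifiedLineKummerEqAt W₂ p) (hT : TorsionIso W₁ W₂ p)
    (S₀ : Finset (HeightOneSpectrum (𝓞 ℚ))) (hS₀ : ∀ w ∈ S₀, ((p : ℕ) : 𝓞 ℚ) ∉ w.asIdeal)
    (hS₁ : ∀ w : HeightOneSpectrum (𝓞 ℚ), w ∉ S₀ → ((p : ℕ) : 𝓞 ℚ) ∉ w.asIdeal →
      W₁.HasGoodReductionAt w)
    (hS₂ : ∀ w : HeightOneSpectrum (𝓞 ℚ), w ∉ S₀ → ((p : ℕ) : 𝓞 ℚ) ∉ w.asIdeal →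
      W₂.HasGoodReductionAt w)
    {κ : ZpExtension ℚ p} {γ : absoluteGaloisGroup ℚ} (hκ : κ.IsCyclotomic)
    (hγ : κ.IsTopGenerator γ) (hγ' : IsCyclotomicVariable p γ)
    (D₁ : W₁.SelmerDualData κ γ) (D₂ : W₂.SelmerDualData κ γ)
    [Module.Finite (IwasawaAlgebra p) D₁.X] [Module.Finite (IwasawaAlgebra p) D₂.X]
    (hX₁ : D₁.IsTorsion) (hX₂ : D₂.IsTorsion) (hμ₁ : D₁.mu = 0) : D₂.mu = 0 := by
  obtain ⟨v, hv⟩ := exists_natCast_mem_asIdeal' (p := p)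
  obtain ⟨L₁, L₂, hL₁, hL₂, hiso⟩ :=
    exists_epwLineData_of_goodOrd_pStar_twist p hp2 V₁ V₂ hCW₁ hCW₂ hV₁ hV₂ hT hv
  exact mu_eq_zero_of_gv W₁ W₂ p S₀ hGV hp2 hv hL₁ hL₂ htors₁ htors₂ hRD₁ hRD₂ hiso hS₀ hS₁ hS₂ hκ hγ
    hγ' D₁ D₂ hX₁ hX₂ hμ₁

end Twists

/-! ## §3. Class forms: X3♯(G-ord) ∩ `I₀*` (the ARM α decl) and X4♯(G-ord) ∩ `I₀*` (EPW-free twin) -/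

section Classes

variable {p : ℕ} [hp : Fact p.Prime] {W₁ W₂ : WeierstrassCurve ℚ} [W₁.IsElliptic]
  [W₁.IsGloballyMinimal] [W₂.IsElliptic] [W₂.IsGloballyMinimal]

/-- **X3♯(G-ord) ∩ `I₀*` congruent pairs (odd `p`): Route G's typed input
`CongruentLambdaShift W₁ W₂ p e`, `e = Σ_{w∈Σ₀} (δ(E₂,w) − δ(E₁,w))`, from GV + `TorsionIso W₁ W₂ p` +
`p ∤ #Eᵢ(ℚ)_tors` + `Σ₀` — NO image binder** (ROUTE-2 II.16.1 (iv): the non-vacuous twin of p10's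
`ClassX3Gord.congruentLambdaShift_of_epw_of_torsionIso`). Both rows' class binders replace the line
data. X3♯(G-ord) stays CONSTRUCTION-SHAPED; nothing booked.
[cite: GreenbergVatsal2000, §2 Prop. (2.8) with Remark (2.9), Cor. (2.3), Prop. (2.4), pp. 26–27 (arXiv:math/9906215)] -/
theorem ClassX3Gord.congruentLambdaShift_of_gv_of_torsionIso
    (hGV : muLambdaAlg_transfer_of_torsionIso_potOrd_of_not_dvd_torsionOrder) (hp2 : p ≠ 2)
    (hX₁ : ClassX3Gord W₁ p) (he₁ : semistabilityIndex W₁ p = 2)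
    (hX₂ : ClassX3Gord W₂ p) (he₂ : semistabilityIndex W₂ p = 2)
    (htors₁ : ¬ p ∣ W₁.torsionOrder) (htors₂ : ¬ p ∣ W₂.torsionOrder)
    (hRD₁ : RamifiedLineKummerEqAt W₁ p) (hRD₂ : RamifiedLineKummerEqAt W₂ p) (hT : TorsionIso W₁ W₂ p)
    (S₀ : Finset (HeightOneSpectrum (𝓞 ℚ))) (hS₀ : ∀ w ∈ S₀, ((p : ℕ) : 𝓞 ℚ) ∉ w.asIdeal)
    (hS₁ : ∀ w : HeightOneSpectrum (𝓞 ℚ), w ∉ S₀ → ((p : ℕ) : 𝓞 ℚ) ∉ w.asIdeal →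
      W₁.HasGoodReductionAt w)
    (hS₂ : ∀ w : HeightOneSpectrum (𝓞 ℚ), w ∉ S₀ → ((p : ℕ) : 𝓞 ℚ) ∉ w.asIdeal →
      W₂.HasGoodReductionAt w) :
    CongruentLambdaShift W₁ W₂ p (∑ w ∈ S₀, ((delta W₂ p w : ℤ) - (delta W₁ p w : ℤ))) := by
  obtain ⟨V₁, _, _, C₁, hV₁, hC₁⟩ := ClassX3Gord.exists_goodOrd_pStar_twist_model W₁ p hp2 hX₁ he₁
  obtain ⟨V₂, _, _, C₂, hV₂, hC₂⟩ := ClassX3Gord.exists_goodOrd_pStar_twist_model W₂ p hp2 hX₂ he₂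
  exact congruentLambdaShift_of_gv_of_goodOrd_pStar_twists p hGV hp2 V₁ V₂ ⟨C₁, hC₁⟩ ⟨C₂, hC₂⟩ hV₁
    hV₂ htors₁ htors₂ hRD₁ hRD₂ hT S₀ hS₀ hS₁ hS₂

/-- **X3♯(G-ord) ∩ `I₀*` congruent pairs (odd `p`): `μ(X(E₁)) = 0 ⟹ μ(X(E₂)) = 0`** from GV +
`TorsionIso` + `p ∤ #Eᵢ(ℚ)_tors` — NO image binder. Nothing booked.
[cite: GreenbergVatsal2000, §2 Prop. (2.8) with Remark (2.9), Cor. (2.3), pp. 26–27 (arXiv:math/9906215)] -/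
theorem ClassX3Gord.mu_eq_zero_of_gv_of_torsionIso
    (hGV : muLambdaAlg_transfer_of_torsionIso_potOrd_of_not_dvd_torsionOrder) (hp2 : p ≠ 2)
    (hX₁ : ClassX3Gord W₁ p) (he₁ : semistabilityIndex W₁ p = 2)
    (hX₂ : ClassX3Gord W₂ p) (he₂ : semistabilityIndex W₂ p = 2)
    (htors₁ : ¬ p ∣ W₁.torsionOrder) (htors₂ : ¬ p ∣ W₂.torsionOrder)
    (hRD₁ : RamifiedLineKummerEqAt W₁ p) (hRD₂ : RamifiedLineKummerEqAt W₂ p) (hT : TorsionIso W₁ W₂ p)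
    (S₀ : Finset (HeightOneSpectrum (𝓞 ℚ))) (hS₀ : ∀ w ∈ S₀, ((p : ℕ) : 𝓞 ℚ) ∉ w.asIdeal)
    (hS₁ : ∀ w : HeightOneSpectrum (𝓞 ℚ), w ∉ S₀ → ((p : ℕ) : 𝓞 ℚ) ∉ w.asIdeal →
      W₁.HasGoodReductionAt w)
    (hS₂ : ∀ w : HeightOneSpectrum (𝓞 ℚ), w ∉ S₀ → ((p : ℕ) : 𝓞 ℚ) ∉ w.asIdeal →
      W₂.HasGoodReductionAt w)
    {κ : ZpExtension ℚ p} {γ : absoluteGaloisGroup ℚ} (hκ : κ.IsCyclotomic)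
    (hγ : κ.IsTopGenerator γ) (hγ' : IsCyclotomicVariable p γ)
    (D₁ : W₁.SelmerDualData κ γ) (D₂ : W₂.SelmerDualData κ γ)
    [Module.Finite (IwasawaAlgebra p) D₁.X] [Module.Finite (IwasawaAlgebra p) D₂.X]
    (hX₁t : D₁.IsTorsion) (hX₂t : D₂.IsTorsion) (hμ₁ : D₁.mu = 0) : D₂.mu = 0 := by
  obtain ⟨V₁, _, _, C₁, hV₁, hC₁⟩ := ClassX3Gord.exists_goodOrd_pStar_twist_model W₁ p hp2 hX₁ he₁
  obtain ⟨V₂, _, _, C₂, hV₂, hC₂⟩ := ClassX3Gord.exists_goodOrd_pStar_twist_model W₂ p hp2 hX₂ he₂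
  exact mu_eq_zero_of_gv_of_goodOrd_pStar_twists p hGV hp2 V₁ V₂ ⟨C₁, hC₁⟩ ⟨C₂, hC₂⟩ hV₁ hV₂ htors₁
    htors₂ hRD₁ hRD₂ hT S₀ hS₀ hS₁ hS₂ hκ hγ hγ' D₁ D₂ hX₁t hX₂t hμ₁

omit [W₁.IsGloballyMinimal] in
/-- On an X4 row the torsion condition of the GV record is automatic: `E[p]` irreducible ⟹ no rational
point of order `p` ⟹ `p ∤ #E(ℚ)_tors` (Mazur 1977 III §5 p. 157, tree
`not_hasIrreducibleModPGaloisRep_of_dvd_torsionOrder`). [cite: Mazur1977, Ch. III §5, p. 157] -/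
theorem ClassX4Gord.not_dvd_torsionOrder (hX : ClassX4Gord W₁ p) : ¬ p ∣ W₁.torsionOrder :=
  fun h ↦ not_hasIrreducibleModPGaloisRep_of_dvd_torsionOrder W₁ p h hX.1.2.2

/-- **X4♯(G-ord) ∩ `I₀*` congruent pairs: `CongruentLambdaShift W₁ W₂ p e` from the GV record +
`TorsionIso W₁ W₂ p` + `Σ₀`** — an EPW-FREE second source for the node that p10's
`ClassX4Gord.congruentLambdaShift_of_epw_of_torsionIso` supplies from the EPW record; the torsion
conditions are discharged by irreducibility (`Irr ⊂ ClassX4`). X4♯(G-ord) stays CONSTRUCTION-SHAPED;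
nothing booked.
[cite: GreenbergVatsal2000, §2 Prop. (2.8) with Remark (2.9), Cor. (2.3), Prop. (2.4), pp. 26–27 (arXiv:math/9906215)] -/
theorem ClassX4Gord.congruentLambdaShift_of_gv_of_torsionIso
    (hGV : muLambdaAlg_transfer_of_torsionIso_potOrd_of_not_dvd_torsionOrder)
    (hX₁ : ClassX4Gord W₁ p) (he₁ : semistabilityIndex W₁ p = 2)
    (hX₂ : ClassX4Gord W₂ p) (he₂ : semistabilityIndex W₂ p = 2)
    (hRD₁ : RamifiedLineKummerEqAt W₁ p) (hRD₂ : RamifiedLineKummerEqAt W₂ p) (hT : TorsionIso W₁ W₂ p)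
    (S₀ : Finset (HeightOneSpectrum (𝓞 ℚ))) (hS₀ : ∀ w ∈ S₀, ((p : ℕ) : 𝓞 ℚ) ∉ w.asIdeal)
    (hS₁ : ∀ w : HeightOneSpectrum (𝓞 ℚ), w ∉ S₀ → ((p : ℕ) : 𝓞 ℚ) ∉ w.asIdeal →
      W₁.HasGoodReductionAt w)
    (hS₂ : ∀ w : HeightOneSpectrum (𝓞 ℚ), w ∉ S₀ → ((p : ℕ) : 𝓞 ℚ) ∉ w.asIdeal →
      W₂.HasGoodReductionAt w) :
    CongruentLambdaShift W₁ W₂ p (∑ w ∈ S₀, ((delta W₂ p w : ℤ) - (delta W₁ p w : ℤ))) := by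
  obtain ⟨V₁, _, _, C₁, hV₁, hC₁⟩ := ClassX4Gord.exists_goodOrd_pStar_twist_model W₁ p hX₁ he₁
  obtain ⟨V₂, _, _, C₂, hV₂, hC₂⟩ := ClassX4Gord.exists_goodOrd_pStar_twist_model W₂ p hX₂ he₂
  exact congruentLambdaShift_of_gv_of_goodOrd_pStar_twists p hGV hX₁.addv.1 V₁ V₂ ⟨C₁, hC₁⟩ ⟨C₂, hC₂⟩
    hV₁ hV₂ hX₁.not_dvd_torsionOrder hX₂.not_dvd_torsionOrder hRD₁ hRD₂ hT S₀ hS₀ hS₁ hS₂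

/-- **X4♯(G-ord) ∩ `I₀*` congruent pairs: `μ(X(E₁)) = 0 ⟹ μ(X(E₂)) = 0`** from the GV record +
`TorsionIso` (EPW-free twin of `ClassX4Gord.mu_eq_zero_of_epw_of_torsionIso`). Nothing booked.
[cite: GreenbergVatsal2000, §2 Prop. (2.8) with Remark (2.9), Cor. (2.3), pp. 26–27 (arXiv:math/9906215)] -/
theorem ClassX4Gord.mu_eq_zero_of_gv_of_torsionIso
    (hGV : muLambdaAlg_transfer_of_torsionIso_potOrd_of_not_dvd_torsionOrder)
    (hX₁ : ClassX4Gord W₁ p) (he₁ : semistabilityIndex W₁ p = 2)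
    (hX₂ : ClassX4Gord W₂ p) (he₂ : semistabilityIndex W₂ p = 2)
    (hRD₁ : RamifiedLineKummerEqAt W₁ p) (hRD₂ : RamifiedLineKummerEqAt W₂ p) (hT : TorsionIso W₁ W₂ p)
    (S₀ : Finset (HeightOneSpectrum (𝓞 ℚ))) (hS₀ : ∀ w ∈ S₀, ((p : ℕ) : 𝓞 ℚ) ∉ w.asIdeal)
    (hS₁ : ∀ w : HeightOneSpectrum (𝓞 ℚ), w ∉ S₀ → ((p : ℕ) : 𝓞 ℚ) ∉ w.asIdeal →
      W₁.HasGoodReductionAt w)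
    (hS₂ : ∀ w : HeightOneSpectrum (𝓞 ℚ), w ∉ S₀ → ((p : ℕ) : 𝓞 ℚ) ∉ w.asIdeal →
      W₂.HasGoodReductionAt w)
    {κ : ZpExtension ℚ p} {γ : absoluteGaloisGroup ℚ} (hκ : κ.IsCyclotomic)
    (hγ : κ.IsTopGenerator γ) (hγ' : IsCyclotomicVariable p γ)
    (D₁ : W₁.SelmerDualData κ γ) (D₂ : W₂.SelmerDualData κ γ)
    [Module.Finite (IwasawaAlgebra p) D₁.X] [Module.Finite (IwasawaAlgebra p) D₂.X]
    (hX₁t : D₁.IsTorsion) (hX₂t : D₂.IsTorsion) (hμ₁ : D₁.mu = 0) : D₂.mu = 0 := by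
  obtain ⟨V₁, _, _, C₁, hV₁, hC₁⟩ := ClassX4Gord.exists_goodOrd_pStar_twist_model W₁ p hX₁ he₁
  obtain ⟨V₂, _, _, C₂, hV₂, hC₂⟩ := ClassX4Gord.exists_goodOrd_pStar_twist_model W₂ p hX₂ he₂
  exact mu_eq_zero_of_gv_of_goodOrd_pStar_twists p hGV hX₁.addv.1 V₁ V₂ ⟨C₁, hC₁⟩ ⟨C₂, hC₂⟩ hV₁ hV₂
    hX₁.not_dvd_torsionOrder hX₂.not_dvd_torsionOrder hRD₁ hRD₂ hT S₀ hS₀ hS₁ hS₂ hκ hγ hγ' D₁ D₂ hX₁t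
    hX₂t hμ₁

/-- CONSISTENCY PROBE (cell rule R5-42 (b) / referee 1 R8): a theorem binding an X3 class column AND an
irreducibility hypothesis on the same curve is vacuous. No theorem of this file binds both; the probe
itself records why the EPW consumer on X3 is content-free. [folklore] -/
example (h : ClassX3Gord W₁ p) (hirr : W₁.HasIrreducibleModPGaloisRep p) : False := h.1.1 hirr

end Classes

end Summit.BirchSwinnertonDyer.Rank1Residual.Additive

end
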